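import Literature.Computability.QuantumComplexity.ShallowCircuitsRing
import Literature.Computability.MetaComplexity.SmolenskyCorrelationRestrict
import Literature.Computability.MetaComplexity.RazborovSmolenskyPoly
import HarnessLib

/-!
# Ring-HLF solutions are not low-degree verifiable (negative knowledge for the residual `DistLiftOdd` / `CoreLiftOdd`)

Stand-alone extraction of Part X of the node file `GridCore.lean` (cell decomp-qadv, lens-6 g4; critic row 25:
«LANDABLE NOW as a Theorems negative-knowledge file --supports the residual»).  Imports tree modules only.

For the measurement pattern `δ₀ ∈ {0,1}^{8t}` (a single `Y` at position `0`) the ring kernel is `K(δ₀) ⊆ {0, 𝟙_odd}`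
(`inKernel_delta0`) with sign bits `0`, so `RingHLF.Rel δ₀ z ⟺ ⊕_{b odd} z_b = 0` (`rel_delta0_iff`), and by Smolensky's
parity bound (`Smolensky.paritySubset_agreement_le` on the odd positions, applied to the Fermat indicator `(V-1)^{p-1}`
of `V ≠ 1`) a polynomial `V : {0,1}^{8t} → 𝔽_p` of degree `≤ D`, `p ≠ 2`, satisfies `[V z = 1] ⟺ Rel δ₀ z` on at most
`2^{4t}·(2^{4t-1} + (p-1)D·C(4t,2t))` of the `2^{8t}` strings (`ring_solutions_not_lowDeg_verifiable`): membership in the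
solution set of ONE fixed ring-HLF instance is parity-hard for `lowDeg(𝔽_p)`.  Consequence for the HardCore / GridCore
routes: the selector that would turn `RingPolyLoss8Odd` into a core by black-box boosting (`GridCore` Part V,
`ringCore8_of_ringSelectors`) cannot be a VERIFYING selector.
-/

open Finset
open Literature.Computability.QuantumComplexity Literature.Computability.MetaComplexity

namespace Summit.QuantumAdvantage.QuantumAdvantage.Theorems

set_option linter.dupNamespace false

section NoVerifier

open RingHLF

/-- The measurement pattern `δ₀`: a single `1` at position `0` of the ring `C_{8t}`. -/
def delta0 (t : ℕ) : Fin (8 * t) → Bool := fun b => decide (b.val = 0)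

/-- The indicator of the odd positions of `C_{8t}`. -/
def oddInd (t : ℕ) : Fin (8 * t) → Bool := fun b => decide (b.val % 2 = 1)

/-- Value of the successor position `nxt` on the `8t`-cycle (arithmetic helper). -/
private theorem nxt_val' {n : ℕ} (b : Fin n) : (nxt b).val = (b.val + 1) % n := rfl
/-- Value of the predecessor position `prv` on the `8t`-cycle (arithmetic helper). -/
private theorem prv_val' {n : ℕ} (b : Fin n) : (prv b).val = (b.val + n - 1) % n := rfl

/-- Boolean helper: unpack the kernel recurrence when the pattern bit is `false`. -/
private theorem eq_of_xor_xor_false_and {a b c : Bool} (h : xor (xor a b) (false && c) = false) : a = b := by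
  revert a b c h; decide

/-- Boolean helper: unpack the kernel recurrence when the pattern bit is `true`. -/
private theorem eq_false_of_xor_xor_true_and {a b c : Bool} (h : xor (xor a b) (true && c) = false)
    (hab : a = b) : c = false := by
  revert a b c h hab; decide

/-- Kernel step: `v ∈ K(δ₀)` forces `v_j = v_{j+2}` (constraint at position `j + 1 ≠ 0`). -/
private theorem inKernel_delta0_step {t : ℕ} {v : Fin (8 * t) → Bool} (hv : InKernel (delta0 t) v)
    (j : ℕ) (hj : j + 2 < 8 * t) : v ⟨j, by omega⟩ = v ⟨j + 2, hj⟩ := by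
  have h := hv ⟨j + 1, by omega⟩
  have hprv : prv (⟨j + 1, by omega⟩ : Fin (8 * t)) = ⟨j, by omega⟩ := Fin.ext (by
    rw [prv_val']; dsimp only
    rw [show j + 1 + 8 * t - 1 = j + 8 * t by omega, Nat.add_mod_right, Nat.mod_eq_of_lt (by omega)])
  have hnxt : nxt (⟨j + 1, by omega⟩ : Fin (8 * t)) = ⟨j + 2, hj⟩ := Fin.ext (by
    rw [nxt_val']; dsimp only; exact Nat.mod_eq_of_lt hj)
  have hδ : delta0 t ⟨j + 1, by omega⟩ = false := by simp [delta0]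
  rw [hprv, hnxt, hδ] at h
  exact eq_of_xor_xor_false_and h

/-- A kernel vector of `δ₀` is constant on even positions (propagation of the kernel recurrence). -/
private theorem inKernel_delta0_even {t : ℕ} (ht : 1 ≤ t) {v : Fin (8 * t) → Bool}
    (hv : InKernel (delta0 t) v) : ∀ i : ℕ, ∀ hi : 2 * i < 8 * t, v ⟨2 * i, hi⟩ = v ⟨0, by omega⟩ := by
  intro i
  induction i with
  | zero => intro hi; rfl
  | succ i ih =>
    intro hi
    have h := inKernel_delta0_step hv (2 * i) (by omega)
    have e : (⟨2 * (i + 1), hi⟩ : Fin (8 * t)) = ⟨2 * i + 2, by omega⟩ := Fin.ext (by dsimp only; omega)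
    rw [e, ← h, ih (by omega)]

/-- A kernel vector of `δ₀` is constant on odd positions (propagation of the kernel recurrence). -/
private theorem inKernel_delta0_odd {t : ℕ} (ht : 1 ≤ t) {v : Fin (8 * t) → Bool}
    (hv : InKernel (delta0 t) v) : ∀ i : ℕ, ∀ hi : 2 * i + 1 < 8 * t, v ⟨2 * i + 1, hi⟩ = v ⟨1, by omega⟩ := by
  intro i
  induction i with
  | zero => intro hi; rfl
  | succ i ih =>
    intro hi
    have h := inKernel_delta0_step hv (2 * i + 1) (by omega)
    have e : (⟨2 * (i + 1) + 1, hi⟩ : Fin (8 * t)) = ⟨2 * i + 1 + 2, by omega⟩ :=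
      Fin.ext (by dsimp only; omega)
    rw [e, ← h, ih (by omega)]

/-- **The ring kernel at `δ₀`**: `K(δ₀) ⊆ {0, 𝟙_odd}` — every kernel vector vanishes at the even positions and is
constant on the odd ones. -/
theorem inKernel_delta0 {t : ℕ} (ht : 1 ≤ t) {v : Fin (8 * t) → Bool} (hv : InKernel (delta0 t) v) :
    ∀ b : Fin (8 * t), v b = (oddInd t b && v ⟨1, by omega⟩) := by
  -- the even class vanishes: constraint at position `0`
  have h0 : v ⟨0, by omega⟩ = false := by
    have h := hv ⟨0, by omega⟩
    have hprv : prv (⟨0, by omega⟩ : Fin (8 * t)) = ⟨2 * (4 * t - 1) + 1, by omega⟩ := Fin.ext (by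
      rw [prv_val']; dsimp only
      rw [Nat.zero_add, Nat.mod_eq_of_lt (by omega)]; omega)
    have hnxt : nxt (⟨0, by omega⟩ : Fin (8 * t)) = ⟨1, by omega⟩ := Fin.ext (by
      rw [nxt_val']; dsimp only; exact Nat.mod_eq_of_lt (by omega))
    have hδ : delta0 t ⟨0, by omega⟩ = true := by simp [delta0]
    rw [hprv, hnxt, hδ, inKernel_delta0_odd ht hv (4 * t - 1)] at h
    exact eq_false_of_xor_xor_true_and h rfl
  intro b
  obtain ⟨i, hi | hi⟩ := Nat.even_or_odd' b.val
  · have hb : b = ⟨2 * i, by omega⟩ := Fin.ext hi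
    have hodd : oddInd t b = false := by simp [oddInd, hi]
    rw [hodd, Bool.false_and, hb, inKernel_delta0_even ht hv i (by omega), h0]
  · have hb : b = ⟨2 * i + 1, by omega⟩ := Fin.ext hi
    have hodd : oddInd t b = true := by simp [oddInd, hi]
    rw [hodd, Bool.true_and, hb, inKernel_delta0_odd ht hv i (by omega)]

/-- `𝟙_odd ∈ K(δ₀)`. -/
theorem oddInd_inKernel {t : ℕ} : InKernel (delta0 t) (oddInd t) := by
  intro b
  have h2 : 2 ∣ 8 * t := ⟨4 * t, by ring⟩
  have e1 : (b.val + 8 * t - 1) % 2 = (b.val + 1) % 2 := by omega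
  have h1 : oddInd t (prv b) = oddInd t (nxt b) := by
    simp only [oddInd, prv_val', nxt_val', Nat.mod_mod_of_dvd _ h2, e1]
  rw [h1, Bool.xor_self, Bool.false_xor]
  by_cases hb : b.val = 0
  · simp [delta0, oddInd, hb]
  · simp [delta0, hb]

/-- The odd-position indicator has no two cyclically adjacent ones: `edgesIn = 0`. -/
theorem edgesIn_oddInd {t : ℕ} : edgesIn (oddInd t) = 0 := by
  have h2 : 2 ∣ 8 * t := ⟨4 * t, by ring⟩
  rw [edgesIn, Finset.card_eq_zero, Finset.filter_eq_empty_iff]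
  intro b _ h
  simp only [oddInd, nxt_val', Nat.mod_mod_of_dvd _ h2, decide_eq_true_eq] at h
  omega

/-- `δ₀` and the odd-position indicator have disjoint supports. -/
theorem wtAnd_delta0_oddInd {t : ℕ} : wtAnd (delta0 t) (oddInd t) = 0 := by
  rw [wtAnd, Finset.card_eq_zero, Finset.filter_eq_empty_iff]
  intro b _ h
  simp only [delta0, oddInd, decide_eq_true_eq] at h
  omega

/-- The sign bit of `δ₀` against the odd-position indicator vanishes. -/
theorem signBit_delta0_oddInd {t : ℕ} : signBit (delta0 t) (oddInd t) = 0 := by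
  rw [signBit, edgesIn_oddInd, wtAnd_delta0_oddInd]

/-- The zero vector has no edges. -/
theorem edgesIn_zero {n : ℕ} : edgesIn (fun _ : Fin n => false) = 0 := by
  rw [edgesIn, Finset.card_eq_zero, Finset.filter_eq_empty_iff]
  intro b _ h
  simp at h

/-- The zero vector meets every pattern in weight `0`. -/
theorem wtAnd_zero {n : ℕ} (x : Fin n → Bool) : wtAnd x (fun _ => false) = 0 := by
  rw [wtAnd, Finset.card_eq_zero, Finset.filter_eq_empty_iff]
  intro b _ h
  simp at h

/-- The sign bit against the zero vector vanishes. -/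
theorem signBit_zero {n : ℕ} (x : Fin n → Bool) : signBit x (fun _ => false) = 0 := by
  rw [signBit, edgesIn_zero, wtAnd_zero]

/-- The zero vector is orthogonal to everything mod 2. -/
theorem dot2_zero {n : ℕ} (z : Fin n → Bool) : dot2 (fun _ => false) z = 0 := by
  rw [dot2, Finset.card_eq_zero.2 (Finset.filter_eq_empty_iff.2 fun b _ h => by simp at h)]

/-- **The ring relation at `δ₀` is a parity**: `Rel δ₀ z ⟺ ⟨𝟙_odd, z⟩ ≡ 0 (mod 2)`. -/
theorem rel_delta0_iff {t : ℕ} (ht : 1 ≤ t) (z : Fin (8 * t) → Bool) :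
    Rel (delta0 t) z ↔ dot2 (oddInd t) z = 0 := by
  constructor
  · intro h
    rw [h (oddInd t) oddInd_inKernel, signBit_delta0_oddInd]
  · intro h0 v hv
    have hvb := inKernel_delta0 ht hv
    cases h1 : v ⟨1, by omega⟩
    · have hv0 : v = fun _ => false := funext fun b => by rw [hvb b, h1, Bool.and_false]
      rw [hv0, dot2_zero, signBit_zero]
    · have hv1 : v = oddInd t := funext fun b => by rw [hvb b, h1, Bool.and_true]
      rw [hv1, h0, signBit_delta0_oddInd]

/-- `dot2` against the odd-position indicator is the parity of the output bits at odd positions. -/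
theorem dot2_oddInd_eq {t : ℕ} (z : Fin (8 * t) → Bool) :
    dot2 (oddInd t) z = ((univ.filter fun i : Fin (8 * t) => i.val % 2 = 1).filter fun i => z i = true).card % 2 := by
  rw [dot2, Finset.filter_filter]
  congr 2
  ext b
  simp [oddInd]

/-- Powers of a low-degree function have degree at most the product bound. -/
private theorem pow_mem_lowDeg_mul {F : Type*} [Field F] {n D : ℕ} {u : Smolensky.CubeFn F n}
    (hu : u ∈ Smolensky.lowDeg F n D) (k : ℕ) : u ^ k ∈ Smolensky.lowDeg F n (k * D) := by
  induction k with
  | zero => rw [pow_zero, zero_mul]; exact Smolensky.one_mem_lowDeg 0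
  | succ k ih => rw [pow_succ, Nat.succ_mul]; exact Smolensky.mul_mem_lowDeg_add ih hu

/-- Counting helper: the number of odd positions among `8t`. -/
private theorem card_filter_odd (t : ℕ) : (univ.filter fun i : Fin (8 * t) => i.val % 2 = 1).card = 4 * t := by
  have hTeq : (univ.filter fun i : Fin (8 * t) => i.val % 2 = 1) =
      univ.image (fun j : Fin (4 * t) => (⟨2 * j.val + 1, by omega⟩ : Fin (8 * t))) := by
    ext i
    simp only [mem_filter, mem_univ, true_and, mem_image]
    constructor
    · intro hi
      exact ⟨⟨i.val / 2, by omega⟩, Fin.ext (by dsimp only; omega)⟩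
    · rintro ⟨j, rfl⟩
      dsimp only
      omega
  rw [hTeq, card_image_of_injective _ fun j j' h => Fin.ext (by
    have := congrArg Fin.val h; dsimp only at this; omega), card_univ, Fintype.card_fin]

/-- **Ring-HLF solutions are not low-degree verifiable** (certified, all `t ≥ 1`, all `D`, all primes `p ≠ 2`): a
polynomial `V : {0,1}^{8t} → 𝔽_p` of degree `≤ D` satisfies `[V z = 1] ⟺ z ∈ R(δ₀, ·)` for at most
`2^{4t}·(2^{4t-1} + (p-1)D·C(4t,2t)) = 2^{8t}·(1/2 + (p-1)D·C(4t,2t)/2^{4t})` strings `z`.  (Smolensky's parity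
bound on the odd positions, applied to the Fermat indicator `(V-1)^{p-1}` of `V ≠ 1`.) -/
theorem ring_solutions_not_lowDeg_verifiable (p : ℕ) [Fact p.Prime] (hp2 : p ≠ 2) {t : ℕ} (ht : 1 ≤ t)
    {D : ℕ} (V : Smolensky.CubeFn (ZMod p) (8 * t)) (hV : V ∈ Smolensky.lowDeg (ZMod p) (8 * t) D) :
    (univ.filter fun z : Fin (8 * t) → Bool => (V z = 1 ↔ Rel (delta0 t) z)).card ≤
      2 ^ (4 * t) * (2 ^ (4 * t - 1) + (p - 1) * D * (4 * t).choose (2 * t)) := by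
  classical
  have hp := (Fact.out : p.Prime)
  have h2F : (2 : ZMod p) ≠ 0 := by
    intro h
    have h' : ((2 : ℕ) : ZMod p) = 0 := by exact_mod_cast h
    rw [ZMod.natCast_eq_zero_iff] at h'
    exact hp2 ((Nat.prime_dvd_prime_iff_eq hp Nat.prime_two).mp h')
  set T : Finset (Fin (8 * t)) := univ.filter fun i : Fin (8 * t) => i.val % 2 = 1 with hT
  have hTcard : T.card = 4 * t := card_filter_odd t
  have hTc : Tᶜ.card = 4 * t := by rw [Finset.card_compl, Fintype.card_fin, hTcard]; omega
  -- the Fermat indicator of `V ≠ 1`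
  set Q : Smolensky.CubeFn (ZMod p) (8 * t) := (V - 1) ^ (p - 1) with hQ
  have hQdeg : Q ∈ Smolensky.lowDeg (ZMod p) (8 * t) ((p - 1) * D) :=
    pow_mem_lowDeg_mul (Submodule.sub_mem _ hV (Smolensky.one_mem_lowDeg D)) (p - 1)
  have hQval : ∀ z, Q z = if V z = 1 then 0 else 1 := by
    intro z
    rw [hQ, Pi.pow_apply, Pi.sub_apply, Pi.one_apply]
    split_ifs with h
    · rw [h, sub_self, zero_pow (by have := hp.two_le; omega)]
    · exact ZMod.pow_card_sub_one_eq_one (sub_ne_zero.2 h)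
  have hsub : (univ.filter fun z : Fin (8 * t) → Bool => (V z = 1 ↔ Rel (delta0 t) z)) ⊆
      univ.filter fun z => Q z = if (T.filter fun i => z i = true).card % 2 = 1 then 1 else 0 := by
    intro z hz
    rw [mem_filter] at hz ⊢
    refine ⟨mem_univ _, ?_⟩
    have hiff := hz.2
    rw [rel_delta0_iff ht, dot2_oddInd_eq, ← hT] at hiff
    rw [hQval]
    by_cases hpar : (T.filter fun i => z i = true).card % 2 = 1
    · rw [if_pos hpar, if_neg]
      intro hV1
      have := hiff.1 hV1
      omega
    · rw [if_neg hpar, if_pos]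
      exact hiff.2 (by omega)
  refine (card_le_card hsub).trans ?_
  have h := Smolensky.paritySubset_agreement_le T h2F hQdeg
  rw [hTc, hTcard, show 4 * t / 2 = 2 * t by omega] at h
  convert h using 3; rfl

end NoVerifier

end Summit.QuantumAdvantage.QuantumAdvantage.Theorems
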